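import Mathlib.RingTheory.AdicCompletion.Algebra
import Mathlib.RingTheory.Ideal.Quotient.Operations
import Literature.RingTheory.CompleteLocalRings.FormalImmersionRigidity
import HarnessLib

/-!
# Formal immersions: the map of adic completions versus level-wise surjectivity

Topic `Literature/RingTheory/CompleteLocalRings`. Companion of `FormalImmersionRigidity.lean`.
B. Mazur, *Rational isogenies of prime degree*, Invent. Math. 44 (1978), §3 p. 142 defines: a
morphism `f : X → Y` of finite type between noetherian schemes is a **formal immersion at `x`** if
"the induced map on the completions of local rings `𝒪̂_{Y,f(x)} → 𝒪̂_{X,x}` is surjective". The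
rigidity file works with the *level-wise* form "`𝒪_{Y,f(x)} → 𝒪_{X,x}/𝔪_xᵏ` is onto for every
`k`". This file relates the two, for a ring homomorphism `φ : A →+* B` and ideals `𝔪 ≤ A`,
`𝔫 ≤ B` with `φ(𝔪) ⊆ 𝔫`, using Mathlib's `AdicCompletion`:

* `exists_completionMap`, `completionMap_unique`, `completionMap_of` — there is a unique ring
  homomorphism `ψ : Â → B̂` (`Â = AdicCompletion 𝔪 A`, `B̂ = AdicCompletion 𝔫 B`) compatible
  with the levels, `B̂ → B/𝔫ᵏ ∘ ψ = (A/𝔪ᵏ → B/𝔫ᵏ) ∘ (Â → A/𝔪ᵏ)`, and it extends `φ`;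
* `surjective_mk_pow_comp_of_surjective_completionMap` — if `ψ` is onto then `A → B/𝔫ᵏ` is
  onto for every `k` (Mazur's definition implies the level-wise form, with no hypothesis);
* `surjective_completionMap_of_graded` — conversely, graded surjectivity (every `y ∈ 𝔫ᵏ` is
  `φ(x) (mod 𝔫ᵏ⁺¹)` for some `x ∈ 𝔪ᵏ`; this follows from the cotangent criterion,
  `FormalImmersionRigidity.exists_mem_pow_sub_mem_pow_succ`, and for a local homomorphism of
  local rings from level-wise surjectivity itself) implies that `ψ` is onto, by successive
  approximation (Matsumura, *Commutative Ring Theory*, Thm. 8.4).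

All statements are about an arbitrary `ψ` satisfying the level compatibility (no new definition).

## References

* [Mazur1978] B. Mazur, *Rational isogenies of prime degree*, Invent. Math. 44 (1978), §3 p. 142.
* [Matsumura1987] H. Matsumura, *Commutative Ring Theory*, §8, Thm. 8.4.
-/

namespace Literature.RingTheory.CompleteLocalRings

open Ideal AdicCompletion

variable {A B : Type*} [CommRing A] [CommRing B] (φ : A →+* B) {𝔪 : Ideal A} {𝔫 : Ideal B}

/-- If `φ(𝔪) ⊆ 𝔫` then `φ(𝔪ᵏ) ⊆ 𝔫ᵏ`. [folklore] -/
theorem pow_le_comap_pow (hφ : 𝔪.map φ ≤ 𝔫) (k : ℕ) : 𝔪 ^ k ≤ (𝔫 ^ k).comap φ := by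
  rw [← Ideal.map_le_iff_le_comap, Ideal.map_pow]
  exact Ideal.pow_right_mono hφ k

/-- **The map of adic completions.** If `φ(𝔪) ⊆ 𝔫` there is a ring homomorphism
`ψ : Â → B̂` between the adic completions which is compatible with all the levels:
`(B̂ → B/𝔫ᵏ) ∘ ψ = (A/𝔪ᵏ → B/𝔫ᵏ) ∘ (Â → A/𝔪ᵏ)`. [folklore] -/
theorem exists_completionMap (hφ : 𝔪.map φ ≤ 𝔫) :
    ∃ ψ : AdicCompletion 𝔪 A →+* AdicCompletion 𝔫 B, ∀ (k : ℕ) (x : AdicCompletion 𝔪 A),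
      evalₐ 𝔫 k (ψ x) =
        Ideal.quotientMap (𝔫 ^ k) φ (pow_le_comap_pow φ hφ k) (evalₐ 𝔪 k x) := by
  let g : (k : ℕ) → AdicCompletion 𝔪 A →+* B ⧸ 𝔫 ^ k := fun k =>
    (Ideal.quotientMap (𝔫 ^ k) φ (pow_le_comap_pow φ hφ k)).comp (evalₐ 𝔪 k).toRingHom
  have hg : ∀ {m n : ℕ} (hle : m ≤ n), (Ideal.Quotient.factorPow 𝔫 hle).comp (g n) = g m := by
    intro m n hle
    refine RingHom.ext fun x => ?_
    obtain ⟨s, rfl⟩ := AdicCompletion.mk_surjective 𝔪 A x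
    simp only [g, RingHom.coe_comp, Function.comp_apply, AlgHom.toRingHom_eq_coe,
      AlgHom.coe_toRingHom, evalₐ_mk, Ideal.quotientMap_mk, Ideal.Quotient.factor_mk]
    refine (Ideal.Quotient.eq).mpr ?_
    rw [← map_sub]
    refine pow_le_comap_pow φ hφ m ?_
    have h := (SModEq.sub_mem).mp (s.property hle).symm
    simpa [Ideal.smul_eq_mul, Ideal.mul_top] using h
  exact ⟨AdicCompletion.liftRingHom 𝔫 g hg, fun k x =>
    (AdicCompletion.evalₐ_liftRingHom 𝔫 g hg k x).trans rfl⟩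

/-- The level-compatible map of completions is unique. [folklore] -/
theorem completionMap_unique (hφ : 𝔪.map φ ≤ 𝔫)
    {ψ₁ ψ₂ : AdicCompletion 𝔪 A →+* AdicCompletion 𝔫 B}
    (h₁ : ∀ (k : ℕ) (x : AdicCompletion 𝔪 A), evalₐ 𝔫 k (ψ₁ x) =
      Ideal.quotientMap (𝔫 ^ k) φ (pow_le_comap_pow φ hφ k) (evalₐ 𝔪 k x))
    (h₂ : ∀ (k : ℕ) (x : AdicCompletion 𝔪 A), evalₐ 𝔫 k (ψ₂ x) =
      Ideal.quotientMap (𝔫 ^ k) φ (pow_le_comap_pow φ hφ k) (evalₐ 𝔪 k x)) : ψ₁ = ψ₂ :=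
  RingHom.ext fun x => ext_evalₐ fun k => by rw [h₁, h₂]

/-- The level-compatible map of completions extends `φ`: `ψ(a) = φ(a)` on the images of `A`
and `B`. [folklore] -/
theorem completionMap_of (hφ : 𝔪.map φ ≤ 𝔫) {ψ : AdicCompletion 𝔪 A →+* AdicCompletion 𝔫 B}
    (hψ : ∀ (k : ℕ) (x : AdicCompletion 𝔪 A), evalₐ 𝔫 k (ψ x) =
      Ideal.quotientMap (𝔫 ^ k) φ (pow_le_comap_pow φ hφ k) (evalₐ 𝔪 k x)) (a : A) :
    ψ (of 𝔪 A a) = of 𝔫 B (φ a) :=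
  ext_evalₐ fun k => by rw [hψ, evalₐ_of, evalₐ_of, Ideal.quotientMap_mk]

/-- **Mazur's definition implies the level-wise one.** If the map of completions `ψ : Â → B̂`
is surjective, then `A → B/𝔫ᵏ` is surjective for every `k` (because `B̂ → B/𝔫ᵏ` is onto and
`Â → B/𝔫ᵏ` factors through `A → A/𝔪ᵏ`). [cite: Mazur1978, §3 p. 142] -/
theorem surjective_mk_pow_comp_of_surjective_completionMap (hφ : 𝔪.map φ ≤ 𝔫)
    {ψ : AdicCompletion 𝔪 A →+* AdicCompletion 𝔫 B}
    (hψ : ∀ (k : ℕ) (x : AdicCompletion 𝔪 A), evalₐ 𝔫 k (ψ x) =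
      Ideal.quotientMap (𝔫 ^ k) φ (pow_le_comap_pow φ hφ k) (evalₐ 𝔪 k x))
    (hsurj : Function.Surjective ψ) (k : ℕ) :
    Function.Surjective ((Ideal.Quotient.mk (𝔫 ^ k)).comp φ) := by
  intro q
  obtain ⟨y, hy⟩ := surjective_evalₐ 𝔫 k q
  obtain ⟨x, rfl⟩ := hsurj y
  obtain ⟨s, rfl⟩ := AdicCompletion.mk_surjective 𝔪 A x
  refine ⟨s.val k, ?_⟩
  rw [← hy, hψ, evalₐ_mk, Ideal.quotientMap_mk]
  rfl

/-- **Successive approximation: graded surjectivity makes the map of completions onto**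
(Matsumura, Thm. 8.4). If `φ(𝔪) ⊆ 𝔫` and every `y ∈ 𝔫ᵏ` is `φ(x) (mod 𝔫ᵏ⁺¹)` for some
`x ∈ 𝔪ᵏ` (for every `k`; at `k = 0` this is the surjectivity of `A → B/𝔫`), then the
level-compatible map of completions `ψ : Â → B̂` is surjective — i.e. `φ` is a formal immersion
in the wording of Mazur 1978, §3 p. 142. Proof: given a compatible sequence `(bₖ)` in `B`,
build `aₖ ∈ A` with `φ(aₖ) ≡ bₖ (mod 𝔫ᵏ)` and `aₖ₊₁ ≡ aₖ (mod 𝔪ᵏ)` recursively.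
[folklore] (Matsumura 1987, Thm. 8.4) -/
theorem surjective_completionMap_of_graded (hφ : 𝔪.map φ ≤ 𝔫)
    {ψ : AdicCompletion 𝔪 A →+* AdicCompletion 𝔫 B}
    (hψ : ∀ (k : ℕ) (x : AdicCompletion 𝔪 A), evalₐ 𝔫 k (ψ x) =
      Ideal.quotientMap (𝔫 ^ k) φ (pow_le_comap_pow φ hφ k) (evalₐ 𝔪 k x))
    (hgr : ∀ (k : ℕ), ∀ y ∈ 𝔫 ^ k, ∃ x ∈ 𝔪 ^ k, φ x - y ∈ 𝔫 ^ (k + 1)) :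
    Function.Surjective ψ := by
  intro y
  obtain ⟨t, rfl⟩ := AdicCompletion.mk_surjective 𝔫 B y
  -- consecutive terms of the Cauchy sequence `t`
  have ht : ∀ k, t.val (k + 1) - t.val k ∈ 𝔫 ^ k := fun k => by
    have h := (SModEq.sub_mem).mp (t.property (Nat.le_succ k)).symm
    simpa [Ideal.smul_eq_mul, Ideal.mul_top] using h
  -- one step of the approximation
  have step : ∀ (k : ℕ) (a : A), ∃ a' : A,
      (φ a - t.val k ∈ 𝔫 ^ k → φ a' - t.val (k + 1) ∈ 𝔫 ^ (k + 1) ∧ a' - a ∈ 𝔪 ^ k) := by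
    intro k a
    by_cases h : φ a - t.val k ∈ 𝔫 ^ k
    · have hy : t.val (k + 1) - φ a ∈ 𝔫 ^ k := by
        have e : t.val (k + 1) - φ a = (t.val (k + 1) - t.val k) - (φ a - t.val k) := by ring
        rw [e]
        exact Ideal.sub_mem _ (ht k) h
      obtain ⟨x, hx, hx'⟩ := hgr k _ hy
      refine ⟨a + x, fun _ => ⟨?_, by simpa using hx⟩⟩
      have e : φ (a + x) - t.val (k + 1) = φ x - (t.val (k + 1) - φ a) := by
        rw [map_add]; ring
      rw [e]
      exact hx'
    · exact ⟨a, fun h' => absurd h' h⟩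
  choose g hg using step
  -- the approximating sequence
  let seq : ℕ → A := fun k => Nat.rec (motive := fun _ => A) 0 (fun k ak => g k ak) k
  have seq_succ : ∀ k, seq (k + 1) = g k (seq k) := fun k => rfl
  have inv : ∀ k, φ (seq k) - t.val k ∈ 𝔫 ^ k := by
    intro k
    induction k with
    | zero => simp [seq]
    | succ k ih => rw [seq_succ]; exact (hg k (seq k) ih).1
  have hdiff : ∀ k, seq (k + 1) - seq k ∈ 𝔪 ^ k := fun k => by
    rw [seq_succ]
    exact (hg k _ (inv k)).2
  have hcauchy : ∀ k, seq k ≡ seq (k + 1) [SMOD (𝔪 ^ k • ⊤ : Submodule A A)] := fun k => by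
    refine (SModEq.sub_mem).mpr ?_
    have h := (𝔪 ^ k).neg_mem (hdiff k)
    simpa [Ideal.smul_eq_mul, Ideal.mul_top] using h
  refine ⟨AdicCompletion.mk 𝔪 A (AdicCauchySequence.mk 𝔪 A seq hcauchy), ext_evalₐ fun k => ?_⟩
  rw [hψ, evalₐ_mk, evalₐ_mk, Ideal.quotientMap_mk]
  exact (Ideal.Quotient.eq).mpr (inv k)

/-! ## The case `𝔪 = φ⁻¹(𝔫)` (local homomorphisms): the two definitions agree -/

/-- When `𝔪 = φ⁻¹(𝔫)` (e.g. a local homomorphism of local rings and their maximal ideals),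
level-wise surjectivity of `A → B/𝔫ᵏ` already gives graded surjectivity: levels `k = 1, 2`
give the residue and cotangent surjectivity, and the cotangent criterion
(`exists_mem_pow_sub_mem_pow_succ`) does the rest. [folklore] -/
theorem graded_of_forall_surjective (hcomap : 𝔫.comap φ = 𝔪)
    (H : ∀ k : ℕ, Function.Surjective ((Ideal.Quotient.mk (𝔫 ^ k)).comp φ)) (k : ℕ) :
    ∀ y ∈ 𝔫 ^ k, ∃ x ∈ 𝔪 ^ k, φ x - y ∈ 𝔫 ^ (k + 1) := by
  have hφ : 𝔪.map φ ≤ 𝔫 := by rw [Ideal.map_le_iff_le_comap, hcomap]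
  have H' : ∀ (k : ℕ) (b : B), ∃ a : A, φ a - b ∈ 𝔫 ^ k := fun k b => by
    obtain ⟨a, ha⟩ := H k (Ideal.Quotient.mk _ b)
    exact ⟨a, (Ideal.Quotient.eq).mp ha⟩
  have hres : ∀ b : B, ∃ a : A, φ a - b ∈ 𝔫 := fun b => by simpa using H' 1 b
  have hcot : ∀ y ∈ 𝔫, ∃ x ∈ 𝔪, φ x - y ∈ 𝔫 ^ 2 := by
    intro y hy
    obtain ⟨a, ha⟩ := H' 2 y
    have hφa : φ a ∈ 𝔫 := by
      have h2 : φ a - y ∈ 𝔫 := Ideal.pow_le_self two_ne_zero ha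
      simpa using Ideal.add_mem _ h2 hy
    refine ⟨a, ?_, ha⟩
    rw [← hcomap]
    exact hφa
  exact exists_mem_pow_sub_mem_pow_succ φ hφ hres hcot k

/-- **The two definitions of a formal immersion agree when `𝔪 = φ⁻¹(𝔫)`.** For such `φ` (in
particular for a local homomorphism of local rings with their maximal ideals) the
level-compatible map of adic completions `ψ : Â → B̂` is surjective (Mazur 1978, §3 p. 142:
"`𝒪̂_{Y,f(x)} → 𝒪̂_{X,x}` is surjective") iff `A → B/𝔫ᵏ` is surjective for every `k` (the
level-wise form used in `FormalImmersionRigidity.lean`). [cite: Mazur1978, §3 p. 142] -/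
theorem surjective_completionMap_iff (hcomap : 𝔫.comap φ = 𝔪)
    {ψ : AdicCompletion 𝔪 A →+* AdicCompletion 𝔫 B}
    (hψ : ∀ (k : ℕ) (x : AdicCompletion 𝔪 A), evalₐ 𝔫 k (ψ x) =
      Ideal.quotientMap (𝔫 ^ k) φ
        (pow_le_comap_pow φ (by rw [Ideal.map_le_iff_le_comap, hcomap]) k) (evalₐ 𝔪 k x)) :
    Function.Surjective ψ ↔
      ∀ k : ℕ, Function.Surjective ((Ideal.Quotient.mk (𝔫 ^ k)).comp φ) := by
  have hφ : 𝔪.map φ ≤ 𝔫 := by rw [Ideal.map_le_iff_le_comap, hcomap]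
  exact ⟨fun h => surjective_mk_pow_comp_of_surjective_completionMap φ hφ hψ h,
    fun H => surjective_completionMap_of_graded φ hφ hψ (graded_of_forall_surjective φ hcomap H)⟩

/-- **Local homomorphisms of local rings**: the map of completed local rings `Â → B̂` is
surjective iff `A → B/𝔪_Bᵏ` is surjective for every `k`. (Here `ψ` is any ring homomorphism
`Â → B̂` compatible with the levels; it exists and is unique, `exists_completionMap`,
`completionMap_unique`.) [cite: Mazur1978, §3 p. 142] -/
theorem surjective_completionMap_iff_of_isLocalHom [IsLocalRing A] [IsLocalRing B]
    [IsLocalHom φ] {ψ : AdicCompletion (IsLocalRing.maximalIdeal A) A →+*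
      AdicCompletion (IsLocalRing.maximalIdeal B) B}
    (hψ : ∀ (k : ℕ) (x : AdicCompletion (IsLocalRing.maximalIdeal A) A),
      evalₐ (IsLocalRing.maximalIdeal B) k (ψ x) =
        Ideal.quotientMap (IsLocalRing.maximalIdeal B ^ k) φ
          (pow_le_comap_pow φ (IsLocalRing.map_maximalIdeal_le φ) k)
          (evalₐ (IsLocalRing.maximalIdeal A) k x)) :
    Function.Surjective ψ ↔
      ∀ k : ℕ, Function.Surjective
        ((Ideal.Quotient.mk (IsLocalRing.maximalIdeal B ^ k)).comp φ) :=
  surjective_completionMap_iff φ (IsLocalRing.maximalIdeal_comap φ) hψ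

end Literature.RingTheory.CompleteLocalRings
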